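import Summits.PneNP.GCT.Max.SF6Arithmetic
import Mathlib.Combinatorics.Enumerative.Catalan.Basic
import Mathlib.Data.Nat.Choose.Vandermonde
import Mathlib.Tactic.IntervalCases
import Mathlib.Tactic.Positivity
import Mathlib.Tactic.Linarith
import Mathlib.Tactic.Ring
import HarnessLib
import HarnessLib.Audit

/-!
# `GCT/Max`: all-`m` arithmetic for the Koszul–Young flattening ceiling — Lemma A for every `m`, the per-`k`
# criterion `S(m,k)·n² ≤ C(n,k+1)²` for `n ≥ 2m+2`, and the stage-2 cell bound `S(m,k)·C(n²,p) ≤ LT` for every `m`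

Cell `pub-gct-max` (HOME `run/shared/lean/pub/pub-gct-max/`), track F, banked input P4 (director-valiant g7 ROW-SUPPLY W1, LEAD
gen 31 desk): the ALL-`m` generalisation of the located negative N-F-1 / C-F-3′ (module `KYCannotSeparatePaddedPerThreeFromFive`,
`m = 3`, `n ≥ 5`). THIS MODULE = the pure-arithmetic layer for general `m`, written and kernel-checked by theory-2 (gen 25);
mathematics: memo `CF3-THEOREM.md` §4 (v1.1 `9ea98dd57dfc3673`, referee-read PASS 2026-08-23; NOT IN PRINT), Lemma A for all `m`.
Mathlib + `Max/SF6Arithmetic` (the smoothing `SF6Smoothing.lambda1_le`) only; everything PROVED; no conjecture of the cell is used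
or asserted. HONEST FRAMING: arithmetic lemmas serving a LOCATED NEGATIVE about ONE family of equations (plain Koszul–Young
flattenings `Λ^p ⊗ S^k`) for padded permanents; occurrence obstructions are ruled out in print (BIP'16) — multiplicity obstructions
are the open door; nothing here is a claim on VP vs VNP or P vs NP.

**Contents.** `KYAllM.chooseSqSum m k = Σ_{l ≤ k} C(m,l)²` (the no-syzygy bound on the order-`k` partials of a padded `m × m`
permanent; `= C(2m,m)` for `k ≥ m`); LEMMA A in integer form `chooseSqSum m k · (k+1)² ≤ C(N,k)²` for `N ≥ 2m+1`, `N ≥ 2k`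
(`KYAllM.lemmaA`): the range `k > m` by `C(2m,m) = (m+1)·Cat_m ≤ Cat_{m+1}² ≤ Cat_k²` and `C(2k,k) = (k+1)·Cat_k` (Catalan numbers),
the range `k ≤ m` by kernel `decide` for `m ≤ 11` and, for `m ≥ 12`, the cases `k ≤ 2` (polynomial), `3 ≤ k ≤ m/2`
(`S ≤ (k+1)C(m,k)²`, `2^k C(m,k) ≤ C(2m+1,k)`, `(k+1)³ ≤ 4^k`) and `m/2 < k ≤ m` (`S ≤ (m+1)C(m,⌊m/2⌋)²`, `(m+1)³ ≤ 4^{⌊m/2⌋}`);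
the per-`k` criterion `KYAllM.perk_criterion : 2m+2 ≤ n → k ≤ (n-1)/2 → chooseSqSum m k · n² ≤ C(n,k+1)²` with its sharpness in `n`
(`KYAllM.perk_criterion_sharp`: it fails at `n = 2m+1`, `k = 1`, every `m ≥ 1`); and the glue with the smoothing
`C(n,k+1)²·C(n²,p) ≤ n²·LT`: `chooseSqSum m k · C(n²,p) ≤ ltCount n (n²-1-p) k` (`n ≥ 2m+2`, `k ≤ (n-1)/2`, `p+1 ≤ n²`), packaged as
the statement `KYStageTwoCellBoundAllM` with `kyStageTwoCellBoundAllM_holds` (at `m = 3` this is `SF6StageTwoCellBound` for `n ≥ 8`).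
Consumer: `Max/KYCannotSeparatePaddedPerAllM` (the node `KYCannotSeparatePaddedPerAllM`: N-F-1 for every `m`, every `n ≥ 2m+2`).
-/

namespace Summit.PneNP.GCT

namespace KYAllM

open Finset

/-! ## The partials bound `S(m,k) = Σ_{l ≤ k} C(m,l)²` -/

/-- `chooseSqSum m k = Σ_{l ≤ k} C(m,l)²`: the no-syzygy bound on the number of independent order-`k` partials of the padded
`m × m` permanent `X₀₀^{n-m}·per_m` (CF3-THEOREM §1). [folklore] -/
def chooseSqSum (m k : ℕ) : ℕ := ∑ l ∈ range (k + 1), (m.choose l) ^ 2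

/-- `S(m,0) = 1`. [folklore] -/
lemma chooseSqSum_zero (m : ℕ) : chooseSqSum m 0 = 1 := by simp [chooseSqSum]

/-- `S(m,k+1) = S(m,k) + C(m,k+1)²`. [folklore] -/
lemma chooseSqSum_succ (m k : ℕ) : chooseSqSum m (k + 1) = chooseSqSum m k + (m.choose (k + 1)) ^ 2 := by
  unfold chooseSqSum; rw [sum_range_succ]

/-- `S(m,1) = 1 + m²`. [folklore] -/
lemma chooseSqSum_one (m : ℕ) : chooseSqSum m 1 = 1 + m ^ 2 := by
  rw [chooseSqSum_succ, chooseSqSum_zero, Nat.choose_one_right]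

/-- `S(m,2) = 1 + m² + C(m,2)²`. [folklore] -/
lemma chooseSqSum_two (m : ℕ) : chooseSqSum m 2 = 1 + m ^ 2 + (m.choose 2) ^ 2 := by
  rw [chooseSqSum_succ, chooseSqSum_one]

/-- `S(m,m) = C(2m,m)` (Vandermonde, `Nat.sum_range_choose_sq`). [folklore] -/
lemma chooseSqSum_self (m : ℕ) : chooseSqSum m m = (2 * m).choose m := Nat.sum_range_choose_sq m

/-- `S(m,k) = C(2m,m)` for `k ≥ m` (the sum truncates). [folklore] -/
lemma chooseSqSum_of_le (m k : ℕ) (h : m ≤ k) : chooseSqSum m k = (2 * m).choose m := by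
  induction k, h using Nat.le_induction with
  | base => exact chooseSqSum_self m
  | succ k hk ih => rw [chooseSqSum_succ, ih, Nat.choose_eq_zero_of_lt (by omega : m < k + 1)]; simp

/-- `S(m,k) ≤ (k+1)·c` whenever every `C(m,l)²`, `l ≤ k`, is `≤ c`. [folklore] -/
lemma chooseSqSum_le_succ_mul (m k c : ℕ) (h : ∀ l ≤ k, (m.choose l) ^ 2 ≤ c) : chooseSqSum m k ≤ (k + 1) * c := by
  have := Finset.sum_le_card_nsmul (range (k + 1)) (fun l => (m.choose l) ^ 2) c
    (fun l hl => h l (by rw [mem_range] at hl; omega))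
  simpa [chooseSqSum] using this

/-! ## Small binomial facts -/

/-- Binomial coefficients increase up to the middle: `C(n,r) ≤ C(n,s)` for `r ≤ s ≤ n/2`. [folklore] -/
lemma choose_mono_below_half (n r s : ℕ) (hrs : r ≤ s) (hs : s ≤ n / 2) : n.choose r ≤ n.choose s := by
  induction s, hrs using Nat.le_induction with
  | base => exact le_rfl
  | succ s hrs ih => exact (ih (by omega)).trans (Nat.choose_le_succ_of_lt_half_left (by omega))

/-- `2^k · m^(k)↓ ≤ (2m+1)^(k)↓` (falling factorials: each factor `2(m-i) ≤ 2m+1-i`). [folklore] -/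
lemma two_pow_mul_descFactorial_le (m k : ℕ) : 2 ^ k * m.descFactorial k ≤ (2 * m + 1).descFactorial k := by
  induction k with
  | zero => simp
  | succ k ih =>
    rw [Nat.descFactorial_succ, Nat.descFactorial_succ, pow_succ]
    calc 2 ^ k * 2 * ((m - k) * m.descFactorial k) = (2 * (m - k)) * (2 ^ k * m.descFactorial k) := by ring
      _ ≤ (2 * m + 1 - k) * (2 * m + 1).descFactorial k := Nat.mul_le_mul (by omega) ih

/-- `2^k · C(m,k) ≤ C(2m+1,k)`. [folklore] -/
lemma two_pow_mul_choose_le (m k : ℕ) : 2 ^ k * m.choose k ≤ (2 * m + 1).choose k := by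
  have h := two_pow_mul_descFactorial_le m k
  rw [Nat.descFactorial_eq_factorial_mul_choose, Nat.descFactorial_eq_factorial_mul_choose] at h
  refine Nat.le_of_mul_le_mul_left ?_ (Nat.factorial_pos k)
  calc k.factorial * (2 ^ k * m.choose k) = 2 ^ k * (k.factorial * m.choose k) := by ring
    _ ≤ k.factorial * (2 * m + 1).choose k := h

/-- `4^k = (2^k)²`. [folklore] -/
lemma four_pow_eq_sq (k : ℕ) : (4 : ℕ) ^ k = (2 ^ k) ^ 2 := by
  rw [show (4 : ℕ) = 2 ^ 2 by norm_num, ← pow_mul, ← pow_mul, mul_comm]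

/-- `(k+1)³ ≤ 4^k` for `k ≥ 3`. [folklore] -/
lemma cube_le_four_pow (k : ℕ) (hk : 3 ≤ k) : (k + 1) ^ 3 ≤ 4 ^ k := by
  induction k, hk using Nat.le_induction with
  | base => norm_num
  | succ k hk ih =>
    have h1 : (k + 1 + 1) ^ 3 ≤ 4 * (k + 1) ^ 3 := by
      obtain ⟨j, rfl⟩ : ∃ j, k = j + 3 := ⟨k - 3, by omega⟩
      nlinarith [sq_nonneg j, sq_nonneg (j * j), Nat.zero_le j, pow_nonneg (Nat.zero_le j) 3]
    calc (k + 1 + 1) ^ 3 ≤ 4 * (k + 1) ^ 3 := h1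
      _ ≤ 4 * 4 ^ k := Nat.mul_le_mul_left 4 ih
      _ = 4 ^ (k + 1) := by ring

/-- `(m+1)³ ≤ 4^{⌊m/2⌋}` for `m ≥ 12`. [folklore] -/
lemma cube_le_four_pow_half (m : ℕ) (hm : 12 ≤ m) : (m + 1) ^ 3 ≤ 4 ^ (m / 2) := by
  have key : ∀ j : ℕ, 6 ≤ j → (2 * j + 2) ^ 3 ≤ 4 ^ j := by
    intro j hj
    induction j, hj using Nat.le_induction with
    | base => norm_num
    | succ j hj ih =>
      have h1 : (2 * (j + 1) + 2) ^ 3 ≤ 4 * (2 * j + 2) ^ 3 := by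
        obtain ⟨i, rfl⟩ : ∃ i, j = i + 6 := ⟨j - 6, by omega⟩
        nlinarith [sq_nonneg i, sq_nonneg (i * i), Nat.zero_le i, pow_nonneg (Nat.zero_le i) 3]
      calc (2 * (j + 1) + 2) ^ 3 ≤ 4 * (2 * j + 2) ^ 3 := h1
        _ ≤ 4 * 4 ^ j := Nat.mul_le_mul_left 4 ih
        _ = 4 ^ (j + 1) := by ring
  calc (m + 1) ^ 3 ≤ (2 * (m / 2) + 2) ^ 3 := Nat.pow_le_pow_left (by omega) 3
    _ ≤ 4 ^ (m / 2) := key (m / 2) (by omega)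

/-- `C(m,⌊m/2⌋) ≤ 2·C(m,⌊m/2⌋+1)` for `m ≥ 2`. [folklore] -/
lemma choose_half_le_two_mul (m : ℕ) (hm : 2 ≤ m) : m.choose (m / 2) ≤ 2 * m.choose (m / 2 + 1) := by
  have h := Nat.choose_succ_right_eq m (m / 2)
  -- h : C(m, j+1) * (j+1) = C(m,j) * (m - j)
  have hpos : 0 < m / 2 + 1 := by omega
  refine Nat.le_of_mul_le_mul_right ?_ hpos
  calc m.choose (m / 2) * (m / 2 + 1) ≤ m.choose (m / 2) * (2 * (m - m / 2)) :=
        Nat.mul_le_mul_left _ (by omega)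
    _ = 2 * (m.choose (m / 2 + 1) * (m / 2 + 1)) := by rw [h]; ring
    _ = 2 * m.choose (m / 2 + 1) * (m / 2 + 1) := by ring

/-! ## Catalan numbers: `C(2m,m) ≤ Cat_{m+1}² ≤ Cat_k²` for `k > m` -/

/-- `Cat_n ≤ Cat_{n+1}` (the term `i = n` of Segner's recurrence). [folklore] -/
lemma catalan_le_catalan_succ (n : ℕ) : catalan n ≤ catalan (n + 1) := by
  rw [catalan_succ]
  have h := Finset.single_le_sum (f := fun i : Fin n.succ => catalan i * catalan (n - i))
    (fun i _ => Nat.zero_le _) (Finset.mem_univ (Fin.last n))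
  simpa using h

/-- The Catalan numbers are non-decreasing. [folklore] -/
lemma catalan_monotone : Monotone catalan := monotone_nat_of_le_succ catalan_le_catalan_succ

/-- `1 ≤ Cat_n`. [folklore] -/
lemma one_le_catalan (n : ℕ) : 1 ≤ catalan n := by
  have h := catalan_monotone (Nat.zero_le n)
  simpa using h

/-- `n+1 ≤ Cat_{n+1}` (Segner's recurrence has `n+1` terms, each `≥ 1`). [folklore] -/
lemma succ_le_catalan_succ (n : ℕ) : n + 1 ≤ catalan (n + 1) := by
  rw [catalan_succ]
  have h := Finset.card_nsmul_le_sum (Finset.univ : Finset (Fin n.succ)) (fun i => catalan i * catalan (n - i)) 1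
    (fun i _ => Nat.one_le_iff_ne_zero.2 (Nat.mul_ne_zero (by have := one_le_catalan i; omega)
      (by have := one_le_catalan (n - i); omega)))
  simpa using h

/-- `C(2m,m) = (m+1)·Cat_m ≤ Cat_{m+1}²`. [folklore] -/
lemma centralBinom_le_catalan_succ_sq (m : ℕ) : m.centralBinom ≤ catalan (m + 1) ^ 2 := by
  rw [← succ_mul_catalan_eq_centralBinom, sq]
  exact Nat.mul_le_mul (succ_le_catalan_succ m) (catalan_le_catalan_succ m)

/-- For `k > m`: `C(2m,m)·(k+1)² ≤ C(2k,k)²` (`= ((k+1)·Cat_k)²`, and `C(2m,m) ≤ Cat_{m+1}² ≤ Cat_k²`). [folklore] -/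
lemma centralBinom_mul_sq_le (m k : ℕ) (h : m < k) : (2 * m).choose m * (k + 1) ^ 2 ≤ ((2 * k).choose k) ^ 2 := by
  rw [← Nat.centralBinom_eq_two_mul_choose, ← Nat.centralBinom_eq_two_mul_choose,
    ← succ_mul_catalan_eq_centralBinom k]
  have h1 : m.centralBinom ≤ catalan k ^ 2 :=
    (centralBinom_le_catalan_succ_sq m).trans (Nat.pow_le_pow_left (catalan_monotone h) 2)
  calc m.centralBinom * (k + 1) ^ 2 ≤ catalan k ^ 2 * (k + 1) ^ 2 := Nat.mul_le_mul_right _ h1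
    _ = ((k + 1) * catalan k) ^ 2 := by ring

/-! ## Lemma A for `k ≤ m`: `S(m,k)·(k+1)² ≤ C(2m+1,k)²` -/

/-- Kernel-friendly binomial (`descFactorial / factorial`, computed by the kernel with GMP arithmetic). [folklore] -/
def binomD (a b : ℕ) : ℕ := a.descFactorial b / b.factorial

/-- `binomD = Nat.choose`. [folklore] -/
lemma binomD_eq (a b : ℕ) : binomD a b = a.choose b := (Nat.choose_eq_descFactorial_div_factorial a b).symm

/-- Kernel-friendly mirror of `chooseSqSum`. [folklore] -/
def chooseSqSumD (m k : ℕ) : ℕ := ∑ l ∈ range (k + 1), (binomD m l) ^ 2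

/-- `chooseSqSumD = chooseSqSum`. [folklore] -/
lemma chooseSqSumD_eq (m k : ℕ) : chooseSqSumD m k = chooseSqSum m k := by simp [chooseSqSumD, chooseSqSum, binomD_eq]

/-- Lemma A for `m ≤ 11`, `k ≤ m`, on the mirrors: 78 numerical inequalities by kernel `decide`. [folklore] -/
theorem lemmaA_tableD : ∀ m ≤ 11, ∀ k ≤ m, chooseSqSumD m k * (k + 1) ^ 2 ≤ (binomD (2 * m + 1) k) ^ 2 := by decide

/-- Lemma A for `m ≤ 11`, `k ≤ m`. [folklore] -/
lemma lemmaA_table (m k : ℕ) (hm : m ≤ 11) (hk : k ≤ m) : chooseSqSum m k * (k + 1) ^ 2 ≤ ((2 * m + 1).choose k) ^ 2 := by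
  rw [← chooseSqSumD_eq, ← binomD_eq]; exact lemmaA_tableD m hm k hk

/-- Lemma A at `k = 1` (`m ≥ 1`): `4(1+m²) ≤ (2m+1)²` — SHARP in `n`: with `C(2m,1) = 2m` in place of `2m+1` it fails. [folklore] -/
lemma lemmaA_one (m : ℕ) (hm : 1 ≤ m) : chooseSqSum m 1 * (1 + 1) ^ 2 ≤ ((2 * m + 1).choose 1) ^ 2 := by
  rw [chooseSqSum_one, Nat.choose_one_right]; nlinarith

/-- `2·C(t+2,2) = (t+2)(t+1)`. [folklore] -/
lemma two_mul_choose_two (t : ℕ) : 2 * (t + 2).choose 2 = (t + 2) * (t + 1) := by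
  have h := Nat.add_one_mul_choose_eq (t + 1) 1
  simp [Nat.choose_one_right] at h
  linarith [h]

/-- Lemma A at `k = 2` (`m ≥ 2`): `9(1+m²+C(m,2)²) ≤ (m(2m+1))²`. [folklore] -/
lemma lemmaA_two (m : ℕ) (hm : 2 ≤ m) : chooseSqSum m 2 * (2 + 1) ^ 2 ≤ ((2 * m + 1).choose 2) ^ 2 := by
  obtain ⟨t, rfl⟩ : ∃ t, m = t + 2 := ⟨m - 2, by omega⟩
  rw [chooseSqSum_two]
  have h1 := two_mul_choose_two t
  have h2 : 2 * (2 * (t + 2) + 1).choose 2 = (2 * t + 5) * (2 * t + 4) := by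
    have := two_mul_choose_two (2 * t + 3)
    rw [show 2 * t + 3 + 2 = 2 * (t + 2) + 1 by ring] at this
    rw [this]; ring
  have key : 4 * ((1 + (t + 2) ^ 2 + ((t + 2).choose 2) ^ 2) * (2 + 1) ^ 2) ≤
      4 * ((2 * (t + 2) + 1).choose 2) ^ 2 := by
    have e1 : 4 * ((1 + (t + 2) ^ 2 + ((t + 2).choose 2) ^ 2) * (2 + 1) ^ 2) =
        36 + 36 * (t + 2) ^ 2 + 9 * (2 * (t + 2).choose 2) ^ 2 := by ring
    have e2 : 4 * ((2 * (t + 2) + 1).choose 2) ^ 2 = (2 * (2 * (t + 2) + 1).choose 2) ^ 2 := by ring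
    rw [e1, e2, h1, h2]
    nlinarith [sq_nonneg t, sq_nonneg (t * t), Nat.zero_le t, pow_nonneg (Nat.zero_le t) 3]
  exact Nat.le_of_mul_le_mul_left key (by norm_num)

/-- Lemma A for `3 ≤ k ≤ m/2`: `S ≤ (k+1)C(m,k)²`, `(k+1)³ ≤ 4^k`, `2^k C(m,k) ≤ C(2m+1,k)`. [folklore] -/
lemma lemmaA_regimeI (m k : ℕ) (hk3 : 3 ≤ k) (hkm : k ≤ m / 2) :
    chooseSqSum m k * (k + 1) ^ 2 ≤ ((2 * m + 1).choose k) ^ 2 := by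
  have hS : chooseSqSum m k ≤ (k + 1) * (m.choose k) ^ 2 :=
    chooseSqSum_le_succ_mul m k _ fun l hl => Nat.pow_le_pow_left (choose_mono_below_half m l k hl hkm) 2
  calc chooseSqSum m k * (k + 1) ^ 2 ≤ (k + 1) * (m.choose k) ^ 2 * (k + 1) ^ 2 := Nat.mul_le_mul_right _ hS
    _ = (k + 1) ^ 3 * (m.choose k) ^ 2 := by ring
    _ ≤ 4 ^ k * (m.choose k) ^ 2 := Nat.mul_le_mul_right _ (cube_le_four_pow k hk3)
    _ = (2 ^ k * m.choose k) ^ 2 := by rw [four_pow_eq_sq]; ring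
    _ ≤ ((2 * m + 1).choose k) ^ 2 := Nat.pow_le_pow_left (two_pow_mul_choose_le m k) 2

/-- Lemma A for `m/2 < k ≤ m`, `m ≥ 12`: `S ≤ (m+1)C(m,⌊m/2⌋)²`, `(m+1)³ ≤ 4^{⌊m/2⌋}`, `C(m,⌊m/2⌋) ≤ 2C(m,⌊m/2⌋+1)`,
`2^{⌊m/2⌋+1} C(m,⌊m/2⌋+1) ≤ C(2m+1,⌊m/2⌋+1) ≤ C(2m+1,k)`. [folklore] -/
lemma lemmaA_regimeII (m k : ℕ) (hm : 12 ≤ m) (hjk : m / 2 < k) (hkm : k ≤ m) :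
    chooseSqSum m k * (k + 1) ^ 2 ≤ ((2 * m + 1).choose k) ^ 2 := by
  set j := m / 2 with hj
  have hS : chooseSqSum m k ≤ (k + 1) * (m.choose j) ^ 2 :=
    chooseSqSum_le_succ_mul m k _ fun l _ => Nat.pow_le_pow_left (Nat.choose_le_middle l m) 2
  have hmono : (2 * m + 1).choose (j + 1) ≤ (2 * m + 1).choose k :=
    choose_mono_below_half (2 * m + 1) (j + 1) k (by omega) (by omega)
  calc chooseSqSum m k * (k + 1) ^ 2 ≤ (k + 1) * (m.choose j) ^ 2 * (k + 1) ^ 2 := Nat.mul_le_mul_right _ hS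
    _ = (k + 1) ^ 3 * (m.choose j) ^ 2 := by ring
    _ ≤ (m + 1) ^ 3 * (m.choose j) ^ 2 := Nat.mul_le_mul_right _ (Nat.pow_le_pow_left (by omega) 3)
    _ ≤ 4 ^ j * (m.choose j) ^ 2 := Nat.mul_le_mul_right _ (cube_le_four_pow_half m hm)
    _ ≤ 4 ^ j * (2 * m.choose (j + 1)) ^ 2 :=
        Nat.mul_le_mul_left _ (Nat.pow_le_pow_left (choose_half_le_two_mul m (by omega)) 2)
    _ = (2 ^ (j + 1) * m.choose (j + 1)) ^ 2 := by rw [four_pow_eq_sq]; ring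
    _ ≤ ((2 * m + 1).choose (j + 1)) ^ 2 := Nat.pow_le_pow_left (two_pow_mul_choose_le m (j + 1)) 2
    _ ≤ ((2 * m + 1).choose k) ^ 2 := Nat.pow_le_pow_left hmono 2

/-- **Lemma A for `k ≤ m`**: `S(m,k)·(k+1)² ≤ C(2m+1,k)²` (table for `m ≤ 11`; cases `k ≤ 2`, regime I, regime II for `m ≥ 12`).
[folklore] -/
theorem lemmaA_le (m k : ℕ) (hk : k ≤ m) : chooseSqSum m k * (k + 1) ^ 2 ≤ ((2 * m + 1).choose k) ^ 2 := by
  rcases Nat.lt_or_ge m 12 with hm | hm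
  · exact lemmaA_table m k (by omega) hk
  rcases Nat.lt_or_ge k 3 with hk3 | hk3
  · interval_cases k
    · simp [chooseSqSum_zero]
    · exact lemmaA_one m (by omega)
    · exact lemmaA_two m (by omega)
  rcases Nat.lt_or_ge (m / 2) k with hjk | hjk
  · exact lemmaA_regimeII m k hm hjk hk
  · exact lemmaA_regimeI m k hk3 hjk

/-- **LEMMA A (all `m`, integer form).** For `N ≥ 2m+1` and `N ≥ 2k`: `S(m,k)·(k+1)² ≤ C(N,k)²`
(CF3-THEOREM §4 with `N = n-1`; `k ≤ m` by `lemmaA_le` and `C(2m+1,k) ≤ C(N,k)`, `k > m` by the Catalan bound and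
`C(2k,k) ≤ C(N,k)`). [folklore] -/
theorem lemmaA (m N k : ℕ) (hN : 2 * m + 1 ≤ N) (hk : 2 * k ≤ N) :
    chooseSqSum m k * (k + 1) ^ 2 ≤ (N.choose k) ^ 2 := by
  rcases Nat.lt_or_ge m k with hmk | hmk
  · rw [chooseSqSum_of_le m k hmk.le]
    exact (centralBinom_mul_sq_le m k hmk).trans (Nat.pow_le_pow_left (Nat.choose_le_choose k hk) 2)
  · exact (lemmaA_le m k hmk).trans (Nat.pow_le_pow_left (Nat.choose_le_choose k hN) 2)

/-! ## The per-`k` criterion and the stage-2 cell bound for every `m` -/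

/-- **Per-`k` criterion (all `m`).** For `n ≥ 2m+2` and `k ≤ (n-1)/2`: `S(m,k)·n² ≤ C(n,k+1)²`
(Lemma A and `(k+1)·C(n,k+1) = n·C(n-1,k)`). At `m = 3` this is `SF6Stage2.perk_criterion_m3` (`n ≥ 8`). [folklore] -/
theorem perk_criterion (m n k : ℕ) (hn : 2 * m + 2 ≤ n) (hk : k ≤ (n - 1) / 2) :
    chooseSqSum m k * n ^ 2 ≤ (n.choose (k + 1)) ^ 2 := by
  obtain ⟨N, rfl⟩ : ∃ N, n = N + 1 := ⟨n - 1, by omega⟩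
  have hA : chooseSqSum m k * (k + 1) ^ 2 ≤ (N.choose k) ^ 2 := lemmaA m N k (by omega) (by omega)
  have hid : (N + 1) * N.choose k = (N + 1).choose (k + 1) * (k + 1) := Nat.add_one_mul_choose_eq N k
  refine Nat.le_of_mul_le_mul_right ?_ (pow_pos (Nat.succ_pos k) 2)
  calc chooseSqSum m k * (N + 1) ^ 2 * (k + 1) ^ 2 = chooseSqSum m k * (k + 1) ^ 2 * (N + 1) ^ 2 := by ring
    _ ≤ (N.choose k) ^ 2 * (N + 1) ^ 2 := Nat.mul_le_mul_right _ hA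
    _ = ((N + 1) * N.choose k) ^ 2 := by ring
    _ = ((N + 1).choose (k + 1)) ^ 2 * (k + 1) ^ 2 := by rw [hid]; ring

/-- **Sharpness of the threshold `n = 2m+2` for this method**: at `n = 2m+1`, `k = 1` the criterion fails for every `m ≥ 1`
(`(1+m²)(2m+1)² > (m(2m+1))² = C(2m+1,2)²`). [folklore] -/
theorem perk_criterion_sharp (m : ℕ) (hm : 1 ≤ m) :
    ¬ (chooseSqSum m 1 * (2 * m + 1) ^ 2 ≤ ((2 * m + 1).choose 2) ^ 2) := by
  obtain ⟨t, rfl⟩ : ∃ t, m = t + 1 := ⟨m - 1, by omega⟩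
  rw [chooseSqSum_one]
  have h2 : 2 * (2 * (t + 1) + 1).choose 2 = (2 * t + 3) * (2 * t + 2) := by
    have := two_mul_choose_two (2 * t + 1)
    rw [show 2 * t + 1 + 2 = 2 * (t + 1) + 1 by ring] at this
    rw [this]; ring
  intro h
  have h4 : 4 * ((1 + (t + 1) ^ 2) * (2 * (t + 1) + 1) ^ 2) ≤ (2 * (2 * (t + 1) + 1).choose 2) ^ 2 := by
    calc 4 * ((1 + (t + 1) ^ 2) * (2 * (t + 1) + 1) ^ 2) ≤ 4 * ((2 * (t + 1) + 1).choose 2) ^ 2 :=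
          Nat.mul_le_mul_left 4 h
      _ = (2 * (2 * (t + 1) + 1).choose 2) ^ 2 := by ring
  rw [h2] at h4
  nlinarith [h4]

/-- **Stage-2 cell bound (all `m`).** For `n ≥ 2m+2`, `k ≤ (n-1)/2`, `p+1 ≤ n²`:
`S(m,k)·C(n²,p) ≤ ltCount n (n²-1-p) k` — per-`k` criterion + smoothing `SF6Smoothing.lambda1_le`
(`C(n,k+1)²·C(n²,p) ≤ n²·LT`); the `p`-dependence cancels (CF3-THEOREM §4: `U⁺ ≤ Λ₁ ≤ LT`). [folklore] -/
theorem stage2_cell (m n p k : ℕ) (hn : 2 * m + 2 ≤ n) (hk : k ≤ (n - 1) / 2) (hp : p + 1 ≤ n * n) :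
    chooseSqSum m k * (n * n).choose p ≤ DetKYLeadingTerms.ltCount n (n * n - 1 - p) k := by
  have h1 := perk_criterion m n k hn hk
  have h2 := SF6Smoothing.lambda1_le n p k hp
  have hn0 : 0 < n ^ 2 := pow_pos (by omega) 2
  refine Nat.le_of_mul_le_mul_right ?_ hn0
  calc chooseSqSum m k * (n * n).choose p * n ^ 2 = (chooseSqSum m k * n ^ 2) * (n * n).choose p := by ring
    _ ≤ (n.choose (k + 1)) ^ 2 * (n * n).choose p := Nat.mul_le_mul_right _ h1
    _ ≤ n ^ 2 * DetKYLeadingTerms.ltCount n (n * n - 1 - p) k := h2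
    _ = DetKYLeadingTerms.ltCount n (n * n - 1 - p) k * n ^ 2 := by ring

end KYAllM

/-! ## The packaged statements of this module (PROVED) -/

/-- **Stage-2 primal cell bound for every `m`.** For all `m`, `n ≥ 2m+2`, `k ≤ (n-1)/2`, `p+1 ≤ n²`:
`(Σ_{l ≤ k} C(m,l)²)·C(n²,p) ≤ ltCount(n, n²-1-p, k)` — the no-syzygy bound of the padded-`per_m` side is below the leading-term
count of the `det_n` side (CF3-THEOREM §4, Lemma A for all `m`: `U⁺ ≤ Λ₁ ≤ LT`; the threshold `2m+2` is sharp for the criterion,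
`KYAllM.perk_criterion_sharp`). A statement of the cell, PROVED below; not a published theorem. [folklore] -/
def KYStageTwoCellBoundAllM : Prop :=
  ∀ m n p k : ℕ, 2 * m + 2 ≤ n → k ≤ (n - 1) / 2 → p + 1 ≤ n * n →
    KYAllM.chooseSqSum m k * (n * n).choose p ≤ DetKYLeadingTerms.ltCount n (n * n - 1 - p) k

/-- `KYStageTwoCellBoundAllM` holds (theory-2's `KYAllM.stage2_cell`). [folklore] -/
theorem kyStageTwoCellBoundAllM_holds : KYStageTwoCellBoundAllM :=
  fun m n p k hn hk hp => KYAllM.stage2_cell m n p k hn hk hp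

/-- **Sharpness in `n` of the per-`k` criterion, every `m ≥ 1`.** At `n = 2m+1` the `k = 1` instance
`S(m,1)·n² ≤ C(n,2)²` FAILS (`(1+m²)(2m+1)² > (m(2m+1))²`): the threshold `n₀(m) = 2m+2` of `KYStageTwoCellBoundAllM` is where the
method (no-syzygy bound vs smoothed leading-term count) starts to work — a statement about THIS chain of inequalities, not about the
true Koszul–Young ranks below `2m+2` (at `m = 3` the cell tables of `KYCannotSeparatePaddedPerThreeFromFive` reach `n = 5`).
A statement of the cell, PROVED below; not a published theorem. [folklore] -/
def KYPerkCriterionSharpAllM : Prop :=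
  ∀ m : ℕ, 1 ≤ m → ¬ (KYAllM.chooseSqSum m 1 * (2 * m + 1) ^ 2 ≤ ((2 * m + 1).choose 2) ^ 2)

/-- `KYPerkCriterionSharpAllM` holds (`KYAllM.perk_criterion_sharp`). [folklore] -/
theorem kyPerkCriterionSharpAllM_holds : KYPerkCriterionSharpAllM :=
  fun m hm => KYAllM.perk_criterion_sharp m hm

end Summit.PneNP.GCT
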